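import Literature.Geometry.Symplectic.SteinDomainShrinking
import Literature.Geometry.Symplectic.SteinBoundaryContact
import Literature.Topology.FourManifolds.MorseAffine
import Mathlib.Geometry.Manifold.Instances.Sphere
import HarnessLib

/-!
# Sector bookkeeping for line `property-r-mazur-halves` of crux `ConvexBisection.ContractibleTwistedDoubleStandard`
(item stmt-SmoothPoincare4-3546, route route-SmoothPoincare4-ConvexBisection; skeletons m4 → m5)

Skeleton m4 (lead c1) split the crux on STEIN-smallness of the halves (a Stein structure with
the given contact planes on `∂W` whose `J`-convex function is Morse of ball or Mazur profile);
skeleton m5 (lead c2) splits on SMOOTH smallness (an adapted Morse function, Milnor 1965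
Def. 3.1, of ball or Mazur profile).  This file proves, kernel-checked, that the reshape only
SHRANK the residual:

* `isMorseAdapted_normalise` — the normalised `J`-convex Morse function
  `φ + (1 - max φ)` of a compact Stein domain is a Morse function adapted to the boundary with
  the same critical points and Morse indices (the boundary is the regular maximal level set of
  `φ`; Gompf 1998 §1, Milnor 1965 Def. 3.1);
* `smoothSmall_of_steinSmall` — a Stein-small half (m4) is smoothly small (m5);
* `nonSmallSector_of_nonMazurSector` — hence m4's residual stub `stub_nonMazurSector` IMPLIES
  m5's residual stub `stub_nonSmallSector` (both displayed verbatim): promoting the m5 residual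
  asks for no more than promoting the m4 residual.
-/

noncomputable section

-- the prescribed namespace `Summit.<P>.<Sub>.…` duplicates `SmoothPoincare4` (P = Sub)
set_option linter.dupNamespace false

open scoped Manifold ContDiff Topology
open Set Function Literature.Topology.FourManifolds Literature.Geometry.Symplectic

namespace Summit.SmoothPoincare4.SmoothPoincare4.Theorems.ContractibleTwistedDoubleStandard.PropertyRMazurHalves

/-- **The normalised `J`-convex Morse function of a Stein domain is adapted to the boundary.**
For a compact Stein domain `(W, S)` with `S.φ` Morse, `f = 1 · φ + (1 - max φ)` is a Morse
function adapted to `∂W` (Milnor 1965, Def. 3.1: `f ≡ 1` and regular on `∂W = {φ = max φ}`,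
`f < 1` on the interior) with the same critical set, the same critical points of every index
and the same Morse index everywhere. [cite: MilnorHCobordism1965, Def. 3.1] -/
theorem isMorseAdapted_normalise {W : Type*} [TopologicalSpace W]
    [ChartedSpace (EuclideanHalfSpace 4) W] [IsManifold (𝓡∂ 4) ∞ W] [CompactSpace W]
    (S : SteinStructure W) (hM : IsMorse (𝓡∂ 4) S.φ) :
    IsMorseAdapted (𝓡∂ 4) (fun x => 1 * S.φ x + (1 - sSup (range S.φ))) ∧
      criticalSet (𝓡∂ 4) (fun x => 1 * S.φ x + (1 - sSup (range S.φ))) = criticalSet (𝓡∂ 4) S.φ ∧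
      (∀ k, criticalSetOfIndex (𝓡∂ 4) (fun x => 1 * S.φ x + (1 - sSup (range S.φ))) k =
        criticalSetOfIndex (𝓡∂ 4) S.φ k) ∧
      (∀ x, morseIndex (𝓡∂ 4) (fun x => 1 * S.φ x + (1 - sSup (range S.φ))) x =
        morseIndex (𝓡∂ 4) S.φ x) := by
  have hdiff : MDifferentiable (𝓡∂ 4) 𝓘(ℝ, ℝ) S.φ := fun x =>
    S.φ_smooth.mdifferentiableAt (by simp)
  have hcrit : ∀ x, IsMCriticalPt (𝓡∂ 4) (fun x => 1 * S.φ x + (1 - sSup (range S.φ))) x ↔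
      IsMCriticalPt (𝓡∂ 4) S.φ x := fun x =>
    isMCriticalPt_const_mul_add_iff one_ne_zero _ (hdiff x)
  refine ⟨⟨hM.const_mul_add one_ne_zero _, fun x hx => ⟨?_, ?_⟩, fun x hx => ?_⟩,
    criticalSet_const_mul_add one_ne_zero _ hdiff,
    fun k => hM.criticalSetOfIndex_const_mul_add one_pos _ k,
    fun x => morseIndex_const_mul_add S.φ one_pos _ x⟩
  · -- `f = 1` on the boundary
    have hb : S.φ x = sSup (range S.φ) := (S.boundary_eq x).1 hx
    simp only [one_mul, hb]; ring
  · -- regular on the boundary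
    rw [hcrit x]
    exact S.regular x hx
  · -- `f < 1` inside
    have hlt : S.φ x < sSup (range S.φ) := (S.isInteriorPoint_iff_φ_lt x).1 hx
    simp only [one_mul]; linarith

/-- **A Stein-small half (skeleton m4) is smoothly small (skeleton m5).**  If some Stein
structure `S` on `W` (with whatever boundary condition) has `S.φ` Morse with at most one
critical point, or with indices `≤ 2` and exactly one critical point of each index `0, 1, 2`
(in m4 the Mazur clause also carries the critical-value order, dropped here), then `W` carries
an adapted Morse function of the same profile — the normalised `S.φ`
(`isMorseAdapted_normalise`). [folklore] -/
theorem smoothSmall_of_steinSmall {W : Type*} [TopologicalSpace W]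
    [ChartedSpace (EuclideanHalfSpace 4) W] [IsManifold (𝓡∂ 4) ∞ W] [CompactSpace W]
    (P : SteinStructure W → Prop) (Q : SteinStructure W → Prop) :
    (∃ S : SteinStructure W, P S ∧ IsMorse (𝓡∂ 4) S.φ ∧
        ((criticalSet (𝓡∂ 4) S.φ).Subsingleton ∨
          ((∀ z, IsMCriticalPt (𝓡∂ 4) S.φ z → morseIndex (𝓡∂ 4) S.φ z ≤ 2) ∧
            (criticalSetOfIndex (𝓡∂ 4) S.φ 0).ncard = 1 ∧ (criticalSetOfIndex (𝓡∂ 4) S.φ 1).ncard = 1 ∧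
            (criticalSetOfIndex (𝓡∂ 4) S.φ 2).ncard = 1 ∧ Q S))) →
    ∃ f : W → ℝ, IsMorseAdapted (𝓡∂ 4) f ∧
      ((criticalSet (𝓡∂ 4) f).Subsingleton ∨
        ((∀ z, IsMCriticalPt (𝓡∂ 4) f z → morseIndex (𝓡∂ 4) f z ≤ 2) ∧
          (criticalSetOfIndex (𝓡∂ 4) f 0).ncard = 1 ∧ (criticalSetOfIndex (𝓡∂ 4) f 1).ncard = 1 ∧
          (criticalSetOfIndex (𝓡∂ 4) f 2).ncard = 1)) := by
  rintro ⟨S, -, hM, hprof⟩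
  obtain ⟨hF, hcs, hidx, hmi⟩ := isMorseAdapted_normalise S hM
  refine ⟨_, hF, ?_⟩
  rcases hprof with hsub | ⟨hle, h0, h1, h2, -⟩
  · left
    rw [hcs]
    exact hsub
  · right
    refine ⟨fun z hz => ?_, by rw [hidx 0]; exact h0, by rw [hidx 1]; exact h1, by rw [hidx 2]; exact h2⟩
    rw [hmi z]
    have hz' : z ∈ criticalSet (𝓡∂ 4) S.φ := by rw [← hcs]; exact hz
    exact hle z hz'

/-- **m4's residual stub implies m5's residual stub** (both statements displayed VERBATIM: the
registered `stub_nonMazurSector` of skeleton m4, lead c1, and the registered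
`stub_nonSmallSector` of skeleton m5, lead c2).  The m5 hypothesis "NOT both halves smoothly
small" implies the m4 hypothesis "NOT both halves Stein-small" by `smoothSmall_of_steinSmall`
applied to each half, so the reshape m4 → m5 only shrank the residual sector. [folklore] -/
theorem nonSmallSector_of_nonMazurSector
    (h4 : ∀ (X : Type) [TopologicalSpace X] [T2Space X] [SecondCountableTopology X] [CompactSpace X]
      [ChartedSpace (EuclideanSpace ℝ (Fin 4)) X] [IsManifold (𝓡 4) ∞ X]
      (W₁ : Type) [TopologicalSpace W₁] [ChartedSpace (EuclideanHalfSpace 4) W₁]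
      [IsManifold (𝓡∂ 4) ∞ W₁] [CompactSpace W₁] [ContractibleSpace W₁]
      (W₂ : Type) [TopologicalSpace W₂] [ChartedSpace (EuclideanHalfSpace 4) W₂]
      [IsManifold (𝓡∂ 4) ∞ W₂] [CompactSpace W₂] [ContractibleSpace W₂]
      (J₁ : SteinStructure W₁) (J₂ : SteinStructure W₂) (e₁ : W₁ → X) (e₂ : W₂ → X),
      Manifold.IsSmoothEmbedding (𝓡∂ 4) (𝓡 4) ∞ e₁ → Manifold.IsSmoothEmbedding (𝓡∂ 4) (𝓡 4) ∞ e₂ →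
      Set.range e₁ ∪ Set.range e₂ = Set.univ →
      Set.range e₁ ∩ Set.range e₂ = e₁ '' (𝓡∂ 4).boundary W₁ →
      Set.range e₁ ∩ Set.range e₂ = e₂ '' (𝓡∂ 4).boundary W₂ →
      (∀ w₁ w₂, e₁ w₁ = e₂ w₂ →
        Submodule.map (mfderiv (𝓡∂ 4) (𝓡 4) e₁ w₁).toLinearMap (contactPlane J₁.J w₁) =
          Submodule.map (mfderiv (𝓡∂ 4) (𝓡 4) e₂ w₂).toLinearMap (contactPlane J₂.J w₂)) →
      ¬ ((∃ S : SteinStructure W₁, (∀ x ∈ (𝓡∂ 4).boundary W₁, contactPlane S.J x = contactPlane J₁.J x) ∧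
          IsMorse (𝓡∂ 4) S.φ ∧
          ((criticalSet (𝓡∂ 4) S.φ).Subsingleton ∨
            ((∀ z, IsMCriticalPt (𝓡∂ 4) S.φ z → morseIndex (𝓡∂ 4) S.φ z ≤ 2) ∧
              (criticalSetOfIndex (𝓡∂ 4) S.φ 0).ncard = 1 ∧ (criticalSetOfIndex (𝓡∂ 4) S.φ 1).ncard = 1 ∧
              (criticalSetOfIndex (𝓡∂ 4) S.φ 2).ncard = 1 ∧
              (∀ p ∈ criticalSetOfIndex (𝓡∂ 4) S.φ 1, ∀ q ∈ criticalSetOfIndex (𝓡∂ 4) S.φ 2,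
                S.φ p ≤ S.φ q)))) ∧
          (∃ S : SteinStructure W₂, (∀ x ∈ (𝓡∂ 4).boundary W₂, contactPlane S.J x = contactPlane J₂.J x) ∧
          IsMorse (𝓡∂ 4) S.φ ∧
          ((criticalSet (𝓡∂ 4) S.φ).Subsingleton ∨
            ((∀ z, IsMCriticalPt (𝓡∂ 4) S.φ z → morseIndex (𝓡∂ 4) S.φ z ≤ 2) ∧
              (criticalSetOfIndex (𝓡∂ 4) S.φ 0).ncard = 1 ∧ (criticalSetOfIndex (𝓡∂ 4) S.φ 1).ncard = 1 ∧
              (criticalSetOfIndex (𝓡∂ 4) S.φ 2).ncard = 1 ∧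
              (∀ p ∈ criticalSetOfIndex (𝓡∂ 4) S.φ 1, ∀ q ∈ criticalSetOfIndex (𝓡∂ 4) S.φ 2,
                S.φ p ≤ S.φ q))))) →
      Nonempty (X ≃ₘ⟮𝓡 4, 𝓡 4⟯ Metric.sphere (0 : EuclideanSpace ℝ (Fin 5)) 1)) :
    ∀ (X : Type) [TopologicalSpace X] [T2Space X] [SecondCountableTopology X] [CompactSpace X]
      [ChartedSpace (EuclideanSpace ℝ (Fin 4)) X] [IsManifold (𝓡 4) ∞ X]
      (W₁ : Type) [TopologicalSpace W₁] [ChartedSpace (EuclideanHalfSpace 4) W₁]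
      [IsManifold (𝓡∂ 4) ∞ W₁] [CompactSpace W₁] [ContractibleSpace W₁]
      (W₂ : Type) [TopologicalSpace W₂] [ChartedSpace (EuclideanHalfSpace 4) W₂]
      [IsManifold (𝓡∂ 4) ∞ W₂] [CompactSpace W₂] [ContractibleSpace W₂]
      (J₁ : SteinStructure W₁) (J₂ : SteinStructure W₂) (e₁ : W₁ → X) (e₂ : W₂ → X),
      Manifold.IsSmoothEmbedding (𝓡∂ 4) (𝓡 4) ∞ e₁ → Manifold.IsSmoothEmbedding (𝓡∂ 4) (𝓡 4) ∞ e₂ →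
      Set.range e₁ ∪ Set.range e₂ = Set.univ →
      Set.range e₁ ∩ Set.range e₂ = e₁ '' (𝓡∂ 4).boundary W₁ →
      Set.range e₁ ∩ Set.range e₂ = e₂ '' (𝓡∂ 4).boundary W₂ →
      (∀ w₁ w₂, e₁ w₁ = e₂ w₂ →
        Submodule.map (mfderiv (𝓡∂ 4) (𝓡 4) e₁ w₁).toLinearMap (contactPlane J₁.J w₁) =
          Submodule.map (mfderiv (𝓡∂ 4) (𝓡 4) e₂ w₂).toLinearMap (contactPlane J₂.J w₂)) →
      ¬ ((∃ f : W₁ → ℝ, IsMorseAdapted (𝓡∂ 4) f ∧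
            ((criticalSet (𝓡∂ 4) f).Subsingleton ∨
              ((∀ z, IsMCriticalPt (𝓡∂ 4) f z → morseIndex (𝓡∂ 4) f z ≤ 2) ∧
                (criticalSetOfIndex (𝓡∂ 4) f 0).ncard = 1 ∧ (criticalSetOfIndex (𝓡∂ 4) f 1).ncard = 1 ∧
                (criticalSetOfIndex (𝓡∂ 4) f 2).ncard = 1))) ∧
          (∃ f : W₂ → ℝ, IsMorseAdapted (𝓡∂ 4) f ∧
            ((criticalSet (𝓡∂ 4) f).Subsingleton ∨
              ((∀ z, IsMCriticalPt (𝓡∂ 4) f z → morseIndex (𝓡∂ 4) f z ≤ 2) ∧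
                (criticalSetOfIndex (𝓡∂ 4) f 0).ncard = 1 ∧ (criticalSetOfIndex (𝓡∂ 4) f 1).ncard = 1 ∧
                (criticalSetOfIndex (𝓡∂ 4) f 2).ncard = 1)))) →
      Nonempty (X ≃ₘ⟮𝓡 4, 𝓡 4⟯ Metric.sphere (0 : EuclideanSpace ℝ (Fin 5)) 1) := by
  intro X _ _ _ _ _ _ W₁ _ _ _ _ _ W₂ _ _ _ _ _ J₁ J₂ e₁ e₂ h1 h2 hcov hL hR hC hsm5
  refine h4 X W₁ W₂ J₁ J₂ e₁ e₂ h1 h2 hcov hL hR hC fun hsm4 => hsm5 ?_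
  obtain ⟨hs1, hs2⟩ := hsm4
  exact ⟨smoothSmall_of_steinSmall
      (fun S => ∀ x ∈ (𝓡∂ 4).boundary W₁, contactPlane S.J x = contactPlane J₁.J x)
      (fun S => ∀ p ∈ criticalSetOfIndex (𝓡∂ 4) S.φ 1, ∀ q ∈ criticalSetOfIndex (𝓡∂ 4) S.φ 2,
        S.φ p ≤ S.φ q) hs1,
    smoothSmall_of_steinSmall
      (fun S => ∀ x ∈ (𝓡∂ 4).boundary W₂, contactPlane S.J x = contactPlane J₂.J x)
      (fun S => ∀ p ∈ criticalSetOfIndex (𝓡∂ 4) S.φ 1, ∀ q ∈ criticalSetOfIndex (𝓡∂ 4) S.φ 2,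
        S.φ p ≤ S.φ q) hs2⟩

end Summit.SmoothPoincare4.SmoothPoincare4.Theorems.ContractibleTwistedDoubleStandard.PropertyRMazurHalves

end
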